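import Literature.Analysis.Pluripotential.MongeAmpereStokes
import Literature.Analysis.Pluripotential.MongeAmpereComparison
import Mathlib.MeasureTheory.Function.Jacobian
import Mathlib.RingTheory.Complex
import Mathlib.RingTheory.Norm.Transitivity
import HarnessLib

/-!
# Chart change for the regular Monge–Ampère mass

Topic `Literature/Analysis/Pluripotential`. Step (P7) of the proof of the named fact
`GuedjZeriahi2007_lelongNumber_eq_zero_of_regularMass_eq` (`NonPluripolarMongeAmpereMass.lean`): the
regular Monge–Ampère mass `regularMass N T` (defined in the fixed affine chart `{z₀ ≠ 0}`) is
unchanged when the homogeneous coordinates are permuted, so that a Lelong pole "at infinity" can be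
moved into the chart. Main statement: `ClosedPositiveOneOneCurrent.exists_swap`.

## Contents

* `leviSesq H a b` — the sesquilinear Levi form `¼(H(a,b) + H(ia,ib)) + ¼i(H(a,ib) − H(ia,b))` of a
  real bilinear form (`leviMatrix g w p q = leviSesq (D²g w) e_p e_q`): `ℂ`-linear in `a`,
  conjugate-linear in `b`, basis expansion `leviSesq_eq_sum`, pull-back by a `ℂ`-linear map
  (`leviSesq_bilinearComp`), and vanishing on `ℓ ∘ S` for bilinear `S` obeying the holomorphic rules
  (`leviSesq_eq_zero_of_holo`).
* `fderiv_fderiv_comp_apply` — second derivative of a composition;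
  `fderiv_fderiv_apply_I_smul`, `fderiv_fderiv_holo_rules` — for maps with `ℂ`-linear derivative,
  `D²μ(ia,ib) = −D²μ(a,b)`, `D²μ(a,ib) = D²μ(ia,b)`.
* `jacobianMatrix`, **`leviMatrix_comp_holo`** (`Levi(u ∘ μ)(w) = Jᵀ Levi(u)(μw) J̄`),
  `det_leviMatrix_comp_holo`, **`heightDensity_comp_holo`** (`MA(u∘μ) = |det J|² MA(u)∘μ`).
* `complexify`, **`det_eq_normSq_det_of_commute_I`** (`det_ℝ L = |det_ℂ L|²`, via
  `LinearMap.det_restrictScalars` and `Algebra.norm_complex_apply`).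
* `moebius i₀ w = (update w i₀ 1)/w_{i₀}` — the chart change, an involution of `{w_{i₀} ≠ 0}`,
  holomorphic there; the coordinate hyperplane is null (`volume_coord_eq_zero`).
* `leviMatrix_log_norm_coord` — `Levi(c log|w_{i₀}|) = 0` off the hyperplane (locally the real part
  of a holomorphic logarithm).
* `IsPlurisubharmonicOn.comp_clm`, `reindexEquiv`, `norm_reindexEquiv`,
  **`lelongNumber_comp_reindexEquiv`** (Lelong numbers are invariant under the isometric reindexing).
* `ClosedPositiveOneOneCurrent.reindex σ` (the current `V ∘ R_σ`), `reindex_swap_pot_chartVec` (the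
  chart relation `V'(1,w) = V(1, μw) + c log|w_{i₀}|`), `mem_regularLocus_and_heightDensity_of_rel`
  (transfer of `C²`-regularity and of the density), **`regularMass_eq_of_rel`** (change of variables
  `lintegral_image_eq_lintegral_abs_det_fderiv_mul`) and **`exists_swap`**.

All definitions have explicit bodies; all statements are proved. [folklore]
-/

noncomputable section

open scoped Topology ENNReal ComplexConjugate
open MeasureTheory Filter Set Metric Complex
open Literature.AlgebraicGeometry.HodgeTheory.BiextensionHeight (leviMatrix heightDensity
  fsPotential chartVec)

namespace Literature.Analysis.Pluripotential

variable {n : ℕ}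

/-! ### The sesquilinear Levi form of a real bilinear form -/

section LeviSesq

/-- The **sesquilinear Levi form** attached to a real bilinear form `H` on `ℂⁿ`:
`ℒ_H(a, b) = ¼(H(a,b) + H(ia,ib)) + ¼ i (H(a,ib) − H(ia,b))`, so that
`leviMatrix g w p q = ℒ_{D²g(w)}(e_p, e_q)` (`leviMatrix_eq_leviSesq`). It is `ℂ`-linear in `a` and
conjugate-linear in `b`. [folklore] -/
def leviSesq (H : (Fin n → ℂ) →L[ℝ] (Fin n → ℂ) →L[ℝ] ℝ) (a b : Fin n → ℂ) : ℂ :=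
  (((H a b + H (I • a) (I • b) : ℝ) : ℂ) + ((H a (I • b) - H (I • a) b : ℝ) : ℂ) * I) / 4

variable (H : (Fin n → ℂ) →L[ℝ] (Fin n → ℂ) →L[ℝ] ℝ)

/-- The Levi matrix is the sesquilinear Levi form of `D²g(w)` on the standard basis. [folklore] -/
theorem leviMatrix_eq_leviSesq (g : (Fin n → ℂ) → ℝ) (w : Fin n → ℂ) (p q : Fin n) :
    leviMatrix g w p q = leviSesq (fderiv ℝ (fderiv ℝ g) w) (Pi.single p 1) (Pi.single q 1) := by
  rw [leviMatrix_apply]; rfl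

/-- Additivity in the first argument. [folklore] -/
theorem leviSesq_add_left (a a' b : Fin n → ℂ) :
    leviSesq H (a + a') b = leviSesq H a b + leviSesq H a' b := by
  simp only [leviSesq, smul_add, map_add, add_apply]
  push_cast; ring

/-- Additivity in the second argument. [folklore] -/
theorem leviSesq_add_right (a b b' : Fin n → ℂ) :
    leviSesq H a (b + b') = leviSesq H a b + leviSesq H a b' := by
  simp only [leviSesq, smul_add, map_add]
  push_cast; ring

/-- Real homogeneity in the first argument. [folklore] -/
theorem leviSesq_smul_left_real (r : ℝ) (a b : Fin n → ℂ) :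
    leviSesq H (r • a) b = r * leviSesq H a b := by
  simp only [leviSesq, smul_comm I r a, map_smul, smul_apply, smul_eq_mul]
  push_cast; ring

/-- Real homogeneity in the second argument. [folklore] -/
theorem leviSesq_smul_right_real (r : ℝ) (a b : Fin n → ℂ) :
    leviSesq H a (r • b) = r * leviSesq H a b := by
  simp only [leviSesq, smul_comm I r b, map_smul, smul_eq_mul]
  push_cast; ring

/-- `ℒ_H(ia, b) = i ℒ_H(a, b)`. [folklore] -/
theorem leviSesq_I_smul_left (a b : Fin n → ℂ) :
    leviSesq H (I • a) b = I * leviSesq H a b := by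
  have h : I • I • a = -a := by rw [smul_smul, I_mul_I, neg_one_smul]
  simp only [leviSesq, h, map_neg, neg_apply]
  apply Complex.ext <;> simp <;> ring

/-- `ℒ_H(a, ib) = -i ℒ_H(a, b)`. [folklore] -/
theorem leviSesq_I_smul_right (a b : Fin n → ℂ) :
    leviSesq H a (I • b) = -I * leviSesq H a b := by
  have h : I • I • b = -b := by rw [smul_smul, I_mul_I, neg_one_smul]
  simp only [leviSesq, h, map_neg]
  apply Complex.ext <;> simp <;> ring

/-- `ℂ`-linearity in the first argument. [folklore] -/
theorem leviSesq_smul_left (c : ℂ) (a b : Fin n → ℂ) :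
    leviSesq H (c • a) b = c * leviSesq H a b := by
  rw [smul_eq_re_smul_add_im_smul c a, leviSesq_add_left, leviSesq_smul_left_real,
    leviSesq_smul_left_real, leviSesq_I_smul_left]
  conv_rhs => rw [← Complex.re_add_im c]
  ring

/-- Conjugate-linearity in the second argument. [folklore] -/
theorem leviSesq_smul_right (c : ℂ) (a b : Fin n → ℂ) :
    leviSesq H a (c • b) = conj c * leviSesq H a b := by
  rw [smul_eq_re_smul_add_im_smul c b, leviSesq_add_right, leviSesq_smul_right_real,
    leviSesq_smul_right_real, leviSesq_I_smul_right]
  conv_rhs => rw [← Complex.re_add_im c, map_add, Complex.conj_ofReal, map_mul, Complex.conj_ofReal,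
    Complex.conj_I]
  ring

/-- Finite additivity in the first argument. [folklore] -/
theorem leviSesq_sum_left {ι : Type*} (s : Finset ι) (a : ι → Fin n → ℂ) (b : Fin n → ℂ) :
    leviSesq H (∑ k ∈ s, a k) b = ∑ k ∈ s, leviSesq H (a k) b := by
  classical
  induction s using Finset.induction_on with
  | empty => simp [leviSesq]
  | insert j s hj ih => rw [Finset.sum_insert hj, Finset.sum_insert hj, leviSesq_add_left, ih]

/-- Finite additivity in the second argument. [folklore] -/
theorem leviSesq_sum_right {ι : Type*} (s : Finset ι) (a : Fin n → ℂ) (b : ι → Fin n → ℂ) :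
    leviSesq H a (∑ k ∈ s, b k) = ∑ k ∈ s, leviSesq H a (b k) := by
  classical
  induction s using Finset.induction_on with
  | empty => simp [leviSesq]
  | insert j s hj ih => rw [Finset.sum_insert hj, Finset.sum_insert hj, leviSesq_add_right, ih]

/-- **Expansion on the standard basis**: `ℒ_H(a, b) = Σ_{k,m} a_k conj(b_m) ℒ_H(e_k, e_m)`.
[folklore] -/
theorem leviSesq_eq_sum (a b : Fin n → ℂ) :
    leviSesq H a b = ∑ k, ∑ m, a k * conj (b m) * leviSesq H (Pi.single k 1) (Pi.single m 1) := by
  conv_lhs => rw [eq_sum_smul_single a, eq_sum_smul_single b]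
  rw [leviSesq_sum_left]
  refine Finset.sum_congr rfl fun k _ ↦ ?_
  rw [leviSesq_smul_left, leviSesq_sum_right, Finset.mul_sum]
  refine Finset.sum_congr rfl fun m _ ↦ ?_
  rw [leviSesq_smul_right]
  ring

/-- Additivity in the bilinear form. [folklore] -/
theorem leviSesq_add (H' : (Fin n → ℂ) →L[ℝ] (Fin n → ℂ) →L[ℝ] ℝ) (a b : Fin n → ℂ) :
    leviSesq (H + H') a b = leviSesq H a b + leviSesq H' a b := by
  simp only [leviSesq, add_apply]
  push_cast; ring

/-- **Pull-back by a `ℂ`-linear map**: if `J(ia) = iJ(a)` then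
`ℒ_{H(J·,J·)}(a,b) = ℒ_H(Ja, Jb)`. [folklore] -/
theorem leviSesq_bilinearComp {J : (Fin n → ℂ) →L[ℝ] (Fin n → ℂ)} (hJ : ∀ a, J (I • a) = I • J a)
    (a b : Fin n → ℂ) : leviSesq (H.bilinearComp J J) a b = leviSesq H (J a) (J b) := by
  simp only [leviSesq, ContinuousLinearMap.bilinearComp_apply, hJ]

/-- **The Levi form kills `ℓ ∘ D²μ` for holomorphic `μ`**: if a vector-valued real bilinear form `S`
satisfies `S(ia, ib) = -S(a,b)` and `S(a, ib) = S(ia, b)` (as the second derivative of a holomorphic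
map does), then `ℒ_{ℓ∘S} = 0` for every real linear functional `ℓ`. [folklore] -/
theorem leviSesq_eq_zero_of_holo {G : Type*} [NormedAddCommGroup G] [NormedSpace ℝ G]
    (S : (Fin n → ℂ) →L[ℝ] (Fin n → ℂ) →L[ℝ] G) (ℓ : G →L[ℝ] ℝ)
    (h1 : ∀ a b, S (I • a) (I • b) = -S a b) (h2 : ∀ a b, S a (I • b) = S (I • a) b)
    (K : (Fin n → ℂ) →L[ℝ] (Fin n → ℂ) →L[ℝ] ℝ) (hK : ∀ a b, K a b = ℓ (S a b)) (a b : Fin n → ℂ) :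
    leviSesq K a b = 0 := by
  simp only [leviSesq, hK, h1, h2, map_neg, add_neg_cancel, sub_self]
  simp

end LeviSesq

/-! ### Second derivative of a composition; holomorphic maps -/

section Composition

variable {E : Type*} [NormedAddCommGroup E] [NormedSpace ℝ E]

/-- **Second derivative of a composition** (order-two Faà di Bruno):
`D²(u ∘ μ)(w)(a, b) = D²u(μw)(Dμ(w)a, Dμ(w)b) + Du(μw)(D²μ(w)(a, b))`. [folklore] -/
theorem fderiv_fderiv_comp_apply {E' F : Type*} [NormedAddCommGroup E'] [NormedSpace ℝ E']
    [NormedAddCommGroup F] [NormedSpace ℝ F] {u : E' → F} {μ : E → E'} {w : E}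
    (hu : ContDiffAt ℝ 2 u (μ w)) (hμ : ContDiffAt ℝ 2 μ w) (a b : E) :
    fderiv ℝ (fderiv ℝ (u ∘ μ)) w a b
      = fderiv ℝ (fderiv ℝ u) (μ w) (fderiv ℝ μ w a) (fderiv ℝ μ w b)
        + fderiv ℝ u (μ w) (fderiv ℝ (fderiv ℝ μ) w a b) := by
  -- near `w`, the chain rule
  have hμc : ContinuousAt μ w := hμ.continuousAt
  have hev : fderiv ℝ (u ∘ μ) =ᶠ[𝓝 w] fun y ↦ (fderiv ℝ u (μ y)).comp (fderiv ℝ μ y) := by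
    have h1 : ∀ᶠ y in 𝓝 w, ContDiffAt ℝ 2 μ y := hμ.eventually (by simp)
    have h2 : ∀ᶠ y in 𝓝 w, ContDiffAt ℝ 2 u (μ y) := hμc.eventually (hu.eventually (by simp))
    filter_upwards [h1, h2] with y hy1 hy2
    exact fderiv_comp y (hy2.differentiableAt (by norm_num)) (hy1.differentiableAt (by norm_num))
  rw [hev.fderiv_eq]
  have hA : HasFDerivAt (fun y ↦ fderiv ℝ u (μ y))
      ((fderiv ℝ (fderiv ℝ u) (μ w)).comp (fderiv ℝ μ w)) w := by
    have h1 : HasFDerivAt (fderiv ℝ u) (fderiv ℝ (fderiv ℝ u) (μ w)) (μ w) :=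
      ((hu.fderiv_right (m := 1) le_rfl).differentiableAt one_ne_zero).hasFDerivAt
    exact h1.comp w (hμ.differentiableAt (by norm_num)).hasFDerivAt
  have hB : HasFDerivAt (fun y ↦ fderiv ℝ μ y) (fderiv ℝ (fderiv ℝ μ) w) w :=
    ((hμ.fderiv_right (m := 1) le_rfl).differentiableAt one_ne_zero).hasFDerivAt
  rw [(hA.clm_comp hB).fderiv]
  simp only [add_apply, ContinuousLinearMap.coe_comp, Function.comp_apply,
    ContinuousLinearMap.compL_apply, ContinuousLinearMap.flip_apply]
  exact add_comm _ _

end Composition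

section Holomorphic

variable {G : Type*} [NormedAddCommGroup G] [NormedSpace ℂ G]

/-- For a map whose real derivative is `ℂ`-linear near `w` ("holomorphic") and which is `C²` at `w`,
the second derivative satisfies `D²μ(w)(a, ib) = i D²μ(w)(a, b)`. [folklore] -/
theorem fderiv_fderiv_apply_I_smul {μ : (Fin n → ℂ) → G} {w : Fin n → ℂ} (hμ : ContDiffAt ℝ 2 μ w)
    (hhol : ∀ᶠ y in 𝓝 w, ∀ b, fderiv ℝ μ y (I • b) = I • fderiv ℝ μ y b) (a b : Fin n → ℂ) :
    fderiv ℝ (fderiv ℝ μ) w a (I • b) = I • fderiv ℝ (fderiv ℝ μ) w a b := by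
  have hd : DifferentiableAt ℝ (fderiv ℝ μ) w :=
    (hμ.fderiv_right (m := 1) le_rfl).differentiableAt one_ne_zero
  have h1 : fderiv ℝ (fderiv ℝ μ) w a (I • b) = fderiv ℝ (fun y ↦ fderiv ℝ μ y (I • b)) w a := by
    rw [fderiv_clm_apply hd (differentiableAt_const _)]
    simp
  have h2 : fderiv ℝ (fderiv ℝ μ) w a b = fderiv ℝ (fun y ↦ fderiv ℝ μ y b) w a := by
    rw [fderiv_clm_apply hd (differentiableAt_const _)]
    simp
  have hev : (fun y ↦ fderiv ℝ μ y (I • b)) =ᶠ[𝓝 w] fun y ↦ I • fderiv ℝ μ y b := by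
    filter_upwards [hhol] with y hy
    exact hy b
  have hdb : DifferentiableAt ℝ (fun y ↦ fderiv ℝ μ y b) w := hd.clm_apply (differentiableAt_const _)
  rw [h1, h2, hev.fderiv_eq, fderiv_fun_const_smul hdb]
  simp

/-- **Levi-type combinations of the second derivative of a holomorphic map vanish**:
`D²μ(ia, ib) = -D²μ(a, b)` and `D²μ(a, ib) = D²μ(ia, b)`. [folklore] -/
theorem fderiv_fderiv_holo_rules {μ : (Fin n → ℂ) → G} {w : Fin n → ℂ} (hμ : ContDiffAt ℝ 2 μ w)
    (hhol : ∀ᶠ y in 𝓝 w, ∀ b, fderiv ℝ μ y (I • b) = I • fderiv ℝ μ y b) (a b : Fin n → ℂ) :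
    fderiv ℝ (fderiv ℝ μ) w (I • a) (I • b) = -fderiv ℝ (fderiv ℝ μ) w a b
      ∧ fderiv ℝ (fderiv ℝ μ) w a (I • b) = fderiv ℝ (fderiv ℝ μ) w (I • a) b := by
  have hsymm : ∀ x y, fderiv ℝ (fderiv ℝ μ) w x y = fderiv ℝ (fderiv ℝ μ) w y x := fun x y ↦
    (hμ.isSymmSndFDerivAt (by simp)).eq x y
  have hI := fderiv_fderiv_apply_I_smul hμ hhol
  refine ⟨?_, ?_⟩
  · rw [hI, hsymm (I • a) b, hI, hsymm b a, smul_smul, I_mul_I, neg_one_smul]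
  · rw [hI, hsymm (I • a) b, hI, hsymm b a]

end Holomorphic

/-! ### The Levi matrix under holomorphic changes of variables -/

section Chain

/-- The complex Jacobian matrix of a map `μ : ℂⁿ → ℂⁿ` at `w`, read off from the real derivative:
`J_{kp} = (Dμ(w) e_p)_k`. [folklore] -/
def jacobianMatrix (μ : (Fin n → ℂ) → (Fin n → ℂ)) (w : Fin n → ℂ) : Matrix (Fin n) (Fin n) ℂ :=
  Matrix.of fun k p ↦ fderiv ℝ μ w (Pi.single p 1) k

/-- **Levi matrix chain rule under a holomorphic map**: for `u : ℂⁿ → ℝ` of class `C²` at `μ(w)` and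
`μ` of class `C²` at `w` with `ℂ`-linear derivative near `w`,
`leviMatrix (u ∘ μ) w = Jᵀ · leviMatrix u (μ w) · J̄`, `J` the complex Jacobian at `w`. [folklore] -/
theorem leviMatrix_comp_holo {u : (Fin n → ℂ) → ℝ} {μ : (Fin n → ℂ) → (Fin n → ℂ)} {w : Fin n → ℂ}
    (hu : ContDiffAt ℝ 2 u (μ w)) (hμ : ContDiffAt ℝ 2 μ w)
    (hhol : ∀ᶠ y in 𝓝 w, ∀ b, fderiv ℝ μ y (I • b) = I • fderiv ℝ μ y b) :
    leviMatrix (u ∘ μ) w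
      = (jacobianMatrix μ w).transpose * leviMatrix u (μ w) * (jacobianMatrix μ w).map conj := by
  have hholw : ∀ b, fderiv ℝ μ w (I • b) = I • fderiv ℝ μ w b := hhol.self_of_nhds
  -- the two pieces of `D²(u ∘ μ)(w)`
  set H := fderiv ℝ (fderiv ℝ u) (μ w) with hH
  set J := fderiv ℝ μ w with hJ
  set S := fderiv ℝ (fderiv ℝ μ) w with hS
  set ℓ := fderiv ℝ u (μ w) with hℓ
  -- `K(a, b) = ℓ (S a b)` as a continuous bilinear map
  set K : (Fin n → ℂ) →L[ℝ] (Fin n → ℂ) →L[ℝ] ℝ :=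
    (ContinuousLinearMap.compL ℝ (Fin n → ℂ) (Fin n → ℂ) ℝ ℓ).comp S with hK
  have hKapp : ∀ a b, K a b = ℓ (S a b) := fun a b ↦ rfl
  have hD2 : fderiv ℝ (fderiv ℝ (u ∘ μ)) w = H.bilinearComp J J + K := by
    ext a b
    rw [fderiv_fderiv_comp_apply hu hμ]
    simp [hKapp, hH, hJ, hS, hℓ]
  obtain hrules := fun a b ↦ fderiv_fderiv_holo_rules hμ hhol a b
  ext p q
  rw [leviMatrix_eq_leviSesq, hD2, leviSesq_add, leviSesq_bilinearComp _ hholw,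
    leviSesq_eq_zero_of_holo S ℓ (fun a b ↦ (hrules a b).1) (fun a b ↦ (hrules a b).2) K hKapp,
    add_zero, leviSesq_eq_sum]
  simp only [Matrix.mul_apply, Matrix.transpose_apply, Matrix.map_apply, jacobianMatrix,
    Matrix.of_apply, Finset.sum_mul]
  rw [Finset.sum_comm]
  refine Finset.sum_congr rfl fun m _ ↦ Finset.sum_congr rfl fun k _ ↦ ?_
  rw [leviMatrix_eq_leviSesq]
  ring

/-- **Determinants**: `det leviMatrix (u ∘ μ) w = |det J|² · det leviMatrix u (μ w)`. [folklore] -/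
theorem det_leviMatrix_comp_holo {u : (Fin n → ℂ) → ℝ} {μ : (Fin n → ℂ) → (Fin n → ℂ)}
    {w : Fin n → ℂ} (hu : ContDiffAt ℝ 2 u (μ w)) (hμ : ContDiffAt ℝ 2 μ w)
    (hhol : ∀ᶠ y in 𝓝 w, ∀ b, fderiv ℝ μ y (I • b) = I • fderiv ℝ μ y b) :
    (leviMatrix (u ∘ μ) w).det
      = ((Complex.normSq (jacobianMatrix μ w).det : ℝ) : ℂ) * (leviMatrix u (μ w)).det := by
  rw [leviMatrix_comp_holo hu hμ hhol, Matrix.det_mul, Matrix.det_mul, Matrix.det_transpose,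
    ← RingHom.mapMatrix_apply, ← RingHom.map_det, Complex.normSq_eq_conj_mul_self]
  simp only [starRingEnd_apply]
  ring

/-- **Monge–Ampère densities under a holomorphic change of variables**:
`MA(u ∘ μ)(w) = |det J_μ(w)|² · MA(u)(μ w)`. [folklore] -/
theorem heightDensity_comp_holo {u : (Fin n → ℂ) → ℝ} {μ : (Fin n → ℂ) → (Fin n → ℂ)}
    {w : Fin n → ℂ} (hu : ContDiffAt ℝ 2 u (μ w)) (hμ : ContDiffAt ℝ 2 μ w)
    (hhol : ∀ᶠ y in 𝓝 w, ∀ b, fderiv ℝ μ y (I • b) = I • fderiv ℝ μ y b) :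
    heightDensity n (u ∘ μ) w
      = Complex.normSq (jacobianMatrix μ w).det * heightDensity n u (μ w) := by
  rw [heightDensity_self_eq, heightDensity_self_eq, det_leviMatrix_comp_holo hu hμ hhol,
    Complex.re_ofReal_mul]
  ring

end Chain

/-! ### The real Jacobian determinant of a map with `ℂ`-linear derivative -/

section RealDet

/-- A real-linear endomorphism of `ℂⁿ` commuting with `i` is `ℂ`-linear; packaged as a `ℂ`-linear
map. [folklore] -/
def complexify (L : (Fin n → ℂ) →L[ℝ] (Fin n → ℂ)) (hL : ∀ a, L (I • a) = I • L a) :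
    (Fin n → ℂ) →ₗ[ℂ] (Fin n → ℂ) where
  toFun := L
  map_add' := L.map_add
  map_smul' := fun c a ↦ by
    rw [smul_eq_re_smul_add_im_smul c a, L.map_add, L.map_smul, L.map_smul, hL, RingHom.id_apply,
      smul_eq_re_smul_add_im_smul c (L a)]

/-- Unfolding of `complexify`. [folklore] -/
theorem complexify_apply (L : (Fin n → ℂ) →L[ℝ] (Fin n → ℂ)) (hL : ∀ a, L (I • a) = I • L a)
    (a : Fin n → ℂ) : complexify L hL a = L a := rfl

/-- Restricting the scalars of `complexify L` gives back `L`. [folklore] -/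
theorem restrictScalars_complexify (L : (Fin n → ℂ) →L[ℝ] (Fin n → ℂ))
    (hL : ∀ a, L (I • a) = I • L a) :
    (complexify L hL).restrictScalars ℝ = (L : (Fin n → ℂ) →ₗ[ℝ] (Fin n → ℂ)) := by
  ext a
  rfl

/-- **`|det_ℝ L| = |det_ℂ L|²`** for a real-linear endomorphism of `ℂⁿ` commuting with `i`: the real
determinant is the norm `N_{ℂ/ℝ}` of the complex determinant, and `det_ℂ L` is the determinant of the
matrix `(L e_p)_k`. [folklore] -/
theorem det_eq_normSq_det_of_commute_I (L : (Fin n → ℂ) →L[ℝ] (Fin n → ℂ))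
    (hL : ∀ a, L (I • a) = I • L a) :
    L.det = Complex.normSq (Matrix.of fun k p ↦ L (Pi.single p 1) k).det := by
  have h1 : L.det = ((complexify L hL).restrictScalars ℝ).det := by
    rw [restrictScalars_complexify]
  rw [h1, LinearMap.det_restrictScalars, Algebra.norm_complex_apply]
  congr 1
  rw [← LinearMap.det_toMatrix']
  congr 1

end RealDet

/-! ### The Möbius map exchanging the charts `{z₀ ≠ 0}` and `{z_i ≠ 0}` -/

section Moebius

variable (i₀ : Fin n)

/-- The change of affine coordinates induced by the transposition of the homogeneous coordinates
`z₀ ↔ z_{i₀+1}`: `μ(w) = (update w i₀ 1) / w_{i₀}`, an involution of `{w_{i₀} ≠ 0}`. [folklore] -/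
def moebius (w : Fin n → ℂ) : Fin n → ℂ :=
  (w i₀)⁻¹ • Function.update w i₀ 1

/-- `μ(w)_{i₀} = 1/w_{i₀}`. [folklore] -/
theorem moebius_apply_self (w : Fin n → ℂ) : moebius i₀ w i₀ = (w i₀)⁻¹ := by
  simp [moebius]

/-- `μ(w)_j = w_j/w_{i₀}` for `j ≠ i₀`. [folklore] -/
theorem moebius_apply_of_ne (w : Fin n → ℂ) {j : Fin n} (hj : j ≠ i₀) :
    moebius i₀ w j = (w i₀)⁻¹ * w j := by
  simp [moebius, Function.update_of_ne hj]

/-- `μ` preserves `{w_{i₀} ≠ 0}`. [folklore] -/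
theorem moebius_apply_self_ne_zero {w : Fin n → ℂ} (hw : w i₀ ≠ 0) : moebius i₀ w i₀ ≠ 0 := by
  rw [moebius_apply_self]; exact inv_ne_zero hw

/-- `μ` is an involution of `{w_{i₀} ≠ 0}`. [folklore] -/
theorem moebius_moebius {w : Fin n → ℂ} (hw : w i₀ ≠ 0) : moebius i₀ (moebius i₀ w) = w := by
  funext j
  by_cases hj : j = i₀
  · subst hj
    rw [moebius_apply_self, moebius_apply_self, inv_inv]
  · rw [moebius_apply_of_ne i₀ _ hj, moebius_apply_of_ne i₀ _ hj, moebius_apply_self]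
    field_simp

/-- `μ` is injective on `{w_{i₀} ≠ 0}`. [folklore] -/
theorem injOn_moebius : InjOn (moebius i₀) {w | w i₀ ≠ 0} := by
  intro w hw w' hw' h
  rw [← moebius_moebius i₀ hw, ← moebius_moebius i₀ hw', h]

/-- Images of subsets of `{w_{i₀} ≠ 0}` under the involution `μ`. [folklore] -/
theorem moebius_image (S : Set (Fin n → ℂ)) (hS : S ⊆ {w | w i₀ ≠ 0}) :
    moebius i₀ '' S = {w | w i₀ ≠ 0 ∧ moebius i₀ w ∈ S} := by
  ext w
  constructor
  · rintro ⟨w', hw', rfl⟩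
    exact ⟨moebius_apply_self_ne_zero i₀ (hS hw'), by rwa [moebius_moebius i₀ (hS hw')]⟩
  · rintro ⟨hw, hμ⟩
    exact ⟨moebius i₀ w, hμ, moebius_moebius i₀ hw⟩

/-- `μ` is holomorphic on `{w_{i₀} ≠ 0}`. [folklore] -/
theorem contDiffAt_complex_moebius {w : Fin n → ℂ} (hw : w i₀ ≠ 0) {m : WithTop ℕ∞} :
    ContDiffAt ℂ m (moebius i₀) w := by
  unfold moebius
  have h1 : ContDiffAt ℂ m (fun w : Fin n → ℂ ↦ (w i₀)⁻¹) w :=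
    (contDiffAt_apply ℂ ℂ i₀ w).inv hw
  refine h1.smul ?_
  refine contDiffAt_pi.2 fun j ↦ ?_
  by_cases hj : j = i₀
  · subst hj
    have : (fun w : Fin n → ℂ ↦ Function.update w j (1 : ℂ) j) = fun _ ↦ 1 := by
      funext w; simp
    rw [this]; exact contDiffAt_const
  · have : (fun w : Fin n → ℂ ↦ Function.update w i₀ (1 : ℂ) j) = fun w ↦ w j := by
      funext w; simp [Function.update_of_ne hj]
    rw [this]; exact contDiffAt_apply ℂ ℂ j w

/-- `μ` is real-smooth on `{w_{i₀} ≠ 0}`. [folklore] -/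
theorem contDiffAt_moebius {w : Fin n → ℂ} (hw : w i₀ ≠ 0) {m : WithTop ℕ∞} :
    ContDiffAt ℝ m (moebius i₀) w :=
  (contDiffAt_complex_moebius i₀ hw).restrict_scalars ℝ

/-- The real derivative of `μ` is `ℂ`-linear at points of `{w_{i₀} ≠ 0}`. [folklore] -/
theorem fderiv_moebius_I_smul {w : Fin n → ℂ} (hw : w i₀ ≠ 0) (b : Fin n → ℂ) :
    fderiv ℝ (moebius i₀) w (I • b) = I • fderiv ℝ (moebius i₀) w b := by
  have hd : DifferentiableAt ℂ (moebius i₀) w :=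
    (contDiffAt_complex_moebius i₀ hw (m := 1)).differentiableAt one_ne_zero
  rw [hd.fderiv_restrictScalars ℝ]
  simp

/-- … and near such points. [folklore] -/
theorem eventually_fderiv_moebius_I_smul {w : Fin n → ℂ} (hw : w i₀ ≠ 0) :
    ∀ᶠ y in 𝓝 w, ∀ b, fderiv ℝ (moebius i₀) y (I • b) = I • fderiv ℝ (moebius i₀) y b := by
  have hopen : IsOpen {y : Fin n → ℂ | y i₀ ≠ 0} := isOpen_ne_fun (continuous_apply i₀) continuous_const
  filter_upwards [hopen.mem_nhds hw] with y hy
  exact fderiv_moebius_I_smul i₀ hy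

/-- `{w_{i₀} ≠ 0}` is open. [folklore] -/
theorem isOpen_ne_zero_coord : IsOpen {w : Fin n → ℂ | w i₀ ≠ 0} :=
  isOpen_ne_fun (continuous_apply i₀) continuous_const

/-- The coordinate hyperplane `{w_{i₀} = 0}` is Lebesgue-null. [folklore] -/
theorem volume_coord_eq_zero : volume {w : Fin n → ℂ | w i₀ = 0} = 0 := by
  have h : {w : Fin n → ℂ | w i₀ = 0}
      = (LinearMap.ker (LinearMap.proj (R := ℝ) (φ := fun _ : Fin n ↦ ℂ) i₀) : Set (Fin n → ℂ)) := by
    ext w; simp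
  rw [h]
  refine Measure.addHaar_submodule volume _ fun htop ↦ ?_
  have hmem : (Pi.single i₀ (1 : ℂ) : Fin n → ℂ) ∈ (⊤ : Submodule ℝ (Fin n → ℂ)) := Submodule.mem_top
  rw [← htop, LinearMap.mem_ker] at hmem
  simp at hmem

end Moebius

/-! ### Pluriharmonic corrections: `leviMatrix (c log |w_{i₀}|) = 0` -/

section Pluriharmonic

variable (i₀ : Fin n)

/-- Near a point with `w_{i₀} ≠ 0`, `c log |y_{i₀}|` is `c Re log(y_{i₀}/w_{i₀}) + c log |w_{i₀}|` with the
principal branch (the quotient is near `1`). [folklore] -/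
theorem eventuallyEq_log_norm_coord {w : Fin n → ℂ} (hw : w i₀ ≠ 0) (c : ℝ) :
    (fun y : Fin n → ℂ ↦ c * Real.log ‖y i₀‖)
      =ᶠ[𝓝 w] fun y ↦ c * (Complex.log (y i₀ * (w i₀)⁻¹)).re + c * Real.log ‖w i₀‖ := by
  have hopen : IsOpen {y : Fin n → ℂ | y i₀ ≠ 0} := isOpen_ne_zero_coord i₀
  filter_upwards [hopen.mem_nhds hw] with y hy
  rw [Complex.log_re, norm_mul, norm_inv, Real.log_mul (norm_ne_zero_iff.2 hy)
    (inv_ne_zero (norm_ne_zero_iff.2 hw)), Real.log_inv]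
  ring

/-- The holomorphic germ `y ↦ log(y_{i₀}/w_{i₀})` is smooth (over `ℂ`) at `w`. [folklore] -/
theorem contDiffAt_complex_log_coord {w : Fin n → ℂ} (hw : w i₀ ≠ 0) {m : WithTop ℕ∞} :
    ContDiffAt ℂ m (fun y : Fin n → ℂ ↦ Complex.log (y i₀ * (w i₀)⁻¹)) w := by
  have h1 : ContDiffAt ℂ m (fun y : Fin n → ℂ ↦ y i₀ * (w i₀)⁻¹) w :=
    (contDiffAt_apply ℂ ℂ i₀ w).mul contDiffAt_const
  have h2 : ContDiffAt ℂ m Complex.log (w i₀ * (w i₀)⁻¹) := by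
    rw [mul_inv_cancel₀ hw]
    exact Complex.contDiffAt_log (by simp [Complex.one_mem_slitPlane])
  exact h2.comp w h1

/-- **The Levi matrix of `c log |w_{i₀}|` vanishes** off the hyperplane `{w_{i₀} = 0}` (it is locally
the real part of a holomorphic function). [folklore] -/
theorem leviMatrix_log_norm_coord {w : Fin n → ℂ} (hw : w i₀ ≠ 0) (c : ℝ) :
    leviMatrix (fun y : Fin n → ℂ ↦ c * Real.log ‖y i₀‖) w = 0 := by
  set F : (Fin n → ℂ) → ℂ := fun y ↦ Complex.log (y i₀ * (w i₀)⁻¹) with hF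
  have hFC : ContDiffAt ℂ 2 F w := contDiffAt_complex_log_coord i₀ hw
  have hF2 : ContDiffAt ℝ 2 F w := hFC.restrict_scalars ℝ
  -- `ℂ`-linearity of `DF` near `w`
  have hopen : IsOpen {y : Fin n → ℂ | y i₀ ≠ 0} := isOpen_ne_zero_coord i₀
  have hhol : ∀ᶠ y in 𝓝 w, ∀ b, fderiv ℝ F y (I • b) = I • fderiv ℝ F y b := by
    have hev : ∀ᶠ y in 𝓝 w, ContDiffAt ℂ 2 F y := hFC.eventually (by simp)
    filter_upwards [hev] with y hy b
    rw [(hy.differentiableAt (by norm_num)).fderiv_restrictScalars ℝ]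
    simp
  -- the real-linear functional `c Re`
  set ℓ : ℂ →L[ℝ] ℝ := c • Complex.reCLM with hℓ
  have hgerm : (fun y : Fin n → ℂ ↦ c * Real.log ‖y i₀‖)
      =ᶠ[𝓝 w] fun y ↦ ℓ (F y) + c * Real.log ‖w i₀‖ := by
    filter_upwards [eventuallyEq_log_norm_coord i₀ hw c] with y hy
    rw [hy, hℓ]
    simp [hF, smul_eq_mul]
  -- second derivative of `ℓ ∘ F + const`
  have hD2 : ∀ a b, fderiv ℝ (fderiv ℝ (fun y : Fin n → ℂ ↦ c * Real.log ‖y i₀‖)) w a b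
      = ℓ (fderiv ℝ (fderiv ℝ F) w a b) := by
    intro a b
    rw [hgerm.fderiv.fderiv_eq]
    have h1 : (fun y ↦ ℓ (F y) + c * Real.log ‖w i₀‖) = (fun y ↦ (ℓ ∘ F) y + c * Real.log ‖w i₀‖) :=
      rfl
    rw [h1]
    have h2 : fderiv ℝ (fun y ↦ (ℓ ∘ F) y + c * Real.log ‖w i₀‖) = fderiv ℝ (ℓ ∘ F) := by
      funext y; exact fderiv_add_const _
    rw [h2, fderiv_fderiv_comp_apply (ℓ.contDiff.contDiffAt) hF2]
    rw [ℓ.fderiv, show fderiv ℝ (fderiv ℝ (⇑ℓ)) (F w) = 0 from by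
      rw [show fderiv ℝ (⇑ℓ) = fun _ ↦ ℓ from funext fun x ↦ ℓ.fderiv]; exact fderiv_const_apply _]
    simp
  ext p q
  rw [leviMatrix_eq_leviSesq, Matrix.zero_apply]
  have hrules := fun a b ↦ fderiv_fderiv_holo_rules hF2 hhol a b
  exact leviSesq_eq_zero_of_holo (fderiv ℝ (fderiv ℝ F) w) ℓ (fun a b ↦ (hrules a b).1)
    (fun a b ↦ (hrules a b).2) _ hD2 _ _

/-- `c log |w_{i₀}|` is smooth off the hyperplane. [folklore] -/
theorem contDiffAt_log_norm_coord {w : Fin n → ℂ} (hw : w i₀ ≠ 0) (c : ℝ) {m : WithTop ℕ∞} :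
    ContDiffAt ℝ m (fun y : Fin n → ℂ ↦ c * Real.log ‖y i₀‖) w := by
  have h1 : ContDiffAt ℝ m (fun y : Fin n → ℂ ↦ ‖y i₀‖) w :=
    (contDiffAt_norm ℝ hw).comp w (contDiffAt_apply ℝ ℂ i₀ w)
  have h2 : ContDiffAt ℝ m (fun y : Fin n → ℂ ↦ Real.log ‖y i₀‖) w := by
    have h := (Real.contDiffAt_log.2 (norm_ne_zero_iff.2 hw)).comp w h1
    exact h
  exact contDiffAt_const.mul h2

end Pluriharmonic

/-! ### Plurisubharmonicity and Lelong numbers under linear reindexing of coordinates -/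

section Reindex

variable {E : Type*} [NormedAddCommGroup E] [NormedSpace ℂ E]
  {E' : Type*} [NormedAddCommGroup E'] [NormedSpace ℂ E']

/-- **Plurisubharmonicity is preserved by composition with a continuous `ℂ`-linear map.**
[folklore] -/
theorem IsPlurisubharmonicOn.comp_clm {u : E' → EReal} {Ω : Set E'} (hu : IsPlurisubharmonicOn u Ω)
    (L : E →L[ℂ] E') : IsPlurisubharmonicOn (u ∘ L) (L ⁻¹' Ω) := by
  refine ⟨hu.1.comp L.continuous.continuousOn (mapsTo_preimage L Ω), fun z hz ↦ hu.2.1 (L z) hz,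
    fun z w ↦ ?_⟩
  have h1 : (fun τ : ℂ ↦ (u ∘ L) (z + τ • w)) = fun τ ↦ u (L z + τ • L w) := by
    funext τ; simp
  have h2 : {τ : ℂ | z + τ • w ∈ L ⁻¹' Ω} = {τ | L z + τ • L w ∈ Ω} := by
    ext τ; simp
  rw [h1, h2]
  exact hu.2.2 (L z) (L w)

end Reindex

section ReindexPi

variable {N : ℕ}

/-- Reindexing the coordinates of `ℂ^{N+1}` by a permutation, as a continuous linear equivalence.
[folklore] -/
def reindexEquiv (σ : Equiv.Perm (Fin (N + 1))) : (Fin (N + 1) → ℂ) ≃L[ℂ] (Fin (N + 1) → ℂ) :=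
  (LinearEquiv.funCongrLeft ℂ ℂ σ).toContinuousLinearEquiv

/-- `(R_σ z)_j = z_{σ j}`. [folklore] -/
@[simp] theorem reindexEquiv_apply (σ : Equiv.Perm (Fin (N + 1))) (z : Fin (N + 1) → ℂ)
    (j : Fin (N + 1)) : reindexEquiv σ z j = z (σ j) := rfl

/-- Reindexing preserves the sup norm. [folklore] -/
theorem norm_reindexEquiv (σ : Equiv.Perm (Fin (N + 1))) (z : Fin (N + 1) → ℂ) :
    ‖reindexEquiv σ z‖ = ‖z‖ := by
  have hle : ∀ (τ : Equiv.Perm (Fin (N + 1))) (y : Fin (N + 1) → ℂ), ‖reindexEquiv τ y‖ ≤ ‖y‖ :=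
    fun τ y ↦ (pi_norm_le_iff_of_nonneg (norm_nonneg y)).2 fun j ↦ by
      rw [reindexEquiv_apply]; exact norm_le_pi_norm y (τ j)
  refine le_antisymm (hle σ z) ?_
  have h := hle σ⁻¹ (reindexEquiv σ z)
  have hid : reindexEquiv σ⁻¹ (reindexEquiv σ z) = z := by
    funext j; simp
  rwa [hid] at h

/-- `R_σ z = 0 ↔ z = 0`. [folklore] -/
theorem reindexEquiv_eq_zero_iff (σ : Equiv.Perm (Fin (N + 1))) (z : Fin (N + 1) → ℂ) :
    reindexEquiv σ z = 0 ↔ z = 0 :=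
  (reindexEquiv σ).map_eq_zero_iff

/-- **Lelong numbers are invariant under reindexing of coordinates** (an isometry):
`ν(V ∘ R_σ, v) = ν(V, R_σ v)`. [folklore] -/
theorem lelongNumber_comp_reindexEquiv (V : (Fin (N + 1) → ℂ) → EReal) (σ : Equiv.Perm (Fin (N + 1)))
    (v : Fin (N + 1) → ℂ) :
    lelongNumber (V ∘ reindexEquiv σ) v = lelongNumber V (reindexEquiv σ v) := by
  rw [lelongNumber_eq_sSup, lelongNumber_eq_sSup]
  congr 1
  ext γ
  simp only [lelongSlopes, mem_setOf_eq]
  refine and_congr_right fun _ ↦ exists_congr fun C ↦ ?_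
  have hmap : map (reindexEquiv σ) (𝓝[≠] v) = 𝓝[≠] (reindexEquiv σ v) :=
    (reindexEquiv σ).toHomeomorph.map_punctured_nhds_eq v
  have hev : ∀ z, ‖reindexEquiv σ z - reindexEquiv σ v‖ = ‖z - v‖ := fun z ↦ by
    rw [← map_sub, norm_reindexEquiv]
  rw [← hmap, Filter.eventually_map]
  simp only [Function.comp_apply, hev]

end ReindexPi

/-! ### The reindexed current and the invariance of the regular mass -/

namespace ClosedPositiveOneOneCurrent

variable {N : ℕ} (T : ClosedPositiveOneOneCurrent N)

/-- **Reindexing the homogeneous coordinates of a current**: `V ↦ V ∘ R_σ` (same degree).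
[folklore] -/
def reindex (σ : Equiv.Perm (Fin (N + 1))) : ClosedPositiveOneOneCurrent N where
  pot := T.pot ∘ reindexEquiv σ
  degree := T.degree
  degree_nonneg := T.degree_nonneg
  isPlurisubharmonicOn_pot := by
    have h := T.isPlurisubharmonicOn_pot.comp_clm
      (reindexEquiv σ : (Fin (N + 1) → ℂ) →L[ℂ] (Fin (N + 1) → ℂ))
    have hset : ((reindexEquiv σ : (Fin (N + 1) → ℂ) →L[ℂ] (Fin (N + 1) → ℂ)) ⁻¹' {0}ᶜ)
        = ({0}ᶜ : Set (Fin (N + 1) → ℂ)) := by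
      ext z
      simp only [mem_preimage, mem_compl_iff, mem_singleton_iff, ContinuousLinearEquiv.coe_coe,
        reindexEquiv_eq_zero_iff]
    rw [hset] at h
    exact h
  isLogHomogeneous_pot := fun a v ha hv ↦ by
    simp only [Function.comp_apply, map_smul]
    exact T.isLogHomogeneous_pot a _ ha (fun h ↦ hv ((reindexEquiv_eq_zero_iff σ v).1 h))
  frequently_ne_bot := fun v hv ↦ by
    have h := T.frequently_ne_bot (reindexEquiv σ v)
      (fun h ↦ hv ((reindexEquiv_eq_zero_iff σ v).1 h))
    have hmap : map (reindexEquiv σ) (𝓝 v) = 𝓝 (reindexEquiv σ v) :=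
      (reindexEquiv σ).toHomeomorph.map_nhds_eq v
    rw [← hmap, Filter.frequently_map] at h
    exact h

/-- The reindexed current has the same degree. [folklore] -/
@[simp] theorem reindex_degree (σ : Equiv.Perm (Fin (N + 1))) : (T.reindex σ).degree = T.degree :=
  rfl

/-- Unfolding of the reindexed potential. [folklore] -/
theorem reindex_pot_apply (σ : Equiv.Perm (Fin (N + 1))) (z : Fin (N + 1) → ℂ) :
    (T.reindex σ).pot z = T.pot (reindexEquiv σ z) := rfl

/-- **Lelong numbers of the reindexed current.** [folklore] -/
theorem lelongNumber_reindex_pot (σ : Equiv.Perm (Fin (N + 1))) (v : Fin (N + 1) → ℂ) :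
    Pluripotential.lelongNumber (T.reindex σ).pot v
      = Pluripotential.lelongNumber T.pot (reindexEquiv σ v) :=
  lelongNumber_comp_reindexEquiv _ _ _

/-- The transposition `z₀ ↔ z_{i₀+1}` on the chart: `R_σ(1, w) = w_{i₀} · (1, μ(w))`. [folklore] -/
theorem reindexEquiv_swap_chartVec {i₀ : Fin N} {w : Fin N → ℂ} (hw : w i₀ ≠ 0) :
    reindexEquiv (Equiv.swap 0 i₀.succ) (chartVec w) = w i₀ • chartVec (moebius i₀ w) := by
  funext j
  simp only [reindexEquiv_apply, Pi.smul_apply, smul_eq_mul]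
  refine Fin.cases ?_ (fun k ↦ ?_) j
  · rw [Equiv.swap_apply_left]
    simp [chartVec]
  · by_cases hk : k = i₀
    · subst hk
      rw [Equiv.swap_apply_right]
      simp [chartVec, moebius_apply_self, hw]
    · have hne : (k.succ : Fin (N + 1)) ≠ i₀.succ := fun h ↦ hk (Fin.succ_injective _ h)
      rw [Equiv.swap_apply_of_ne_of_ne (Fin.succ_ne_zero k) hne]
      simp [chartVec, moebius_apply_of_ne i₀ w hk]
      field_simp

/-- **The chart relation**: on `{w_{i₀} ≠ 0}`, the cone potential of the reindexed current at
`(1, w)` is `V(1, μ w) + c log |w_{i₀}|`. [folklore] -/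
theorem reindex_swap_pot_chartVec (i₀ : Fin N) {w : Fin N → ℂ} (hw : w i₀ ≠ 0) :
    (T.reindex (Equiv.swap 0 i₀.succ)).pot (chartVec w)
      = T.pot (chartVec (moebius i₀ w)) + ((T.degree * Real.log ‖w i₀‖ : ℝ) : EReal) := by
  rw [reindex_pot_apply, reindexEquiv_swap_chartVec hw]
  exact T.isLogHomogeneous_pot (w i₀) _ hw (chartVec_ne_zero _)

/-- The chart relation is symmetric (since `μ` is an involution and `log |1/w| = -log |w|`).
[folklore] -/
theorem rel_symm {T₁ T₂ : ClosedPositiveOneOneCurrent N} (i₀ : Fin N) {c : ℝ}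
    (hrel : ∀ w : Fin N → ℂ, w i₀ ≠ 0 →
      T₂.pot (chartVec w) = T₁.pot (chartVec (moebius i₀ w)) + ((c * Real.log ‖w i₀‖ : ℝ) : EReal))
    (w : Fin N → ℂ) (hw : w i₀ ≠ 0) :
    T₁.pot (chartVec w) = T₂.pot (chartVec (moebius i₀ w)) + ((c * Real.log ‖w i₀‖ : ℝ) : EReal) := by
  rw [hrel (moebius i₀ w) (moebius_apply_self_ne_zero i₀ hw), moebius_moebius i₀ hw,
    moebius_apply_self, norm_inv, Real.log_inv, add_assoc, ← EReal.coe_add]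
  have : c * -Real.log ‖w i₀‖ + c * Real.log ‖w i₀‖ = 0 := by ring
  rw [this, EReal.coe_zero, add_zero]

/-- **Transfer of regularity and of the Monge–Ampère density across the chart change.** If the cone
potentials satisfy the chart relation and `μ(w) ∈ Reg(T₁)`, then `w ∈ Reg(T₂)` and
`MA(g₂)(w) = |det J_μ(w)|² MA(g₁)(μ w)`. [folklore] -/
theorem mem_regularLocus_and_heightDensity_of_rel {T₁ T₂ : ClosedPositiveOneOneCurrent N} (i₀ : Fin N)
    {c : ℝ}
    (hrel : ∀ w : Fin N → ℂ, w i₀ ≠ 0 →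
      T₂.pot (chartVec w) = T₁.pot (chartVec (moebius i₀ w)) + ((c * Real.log ‖w i₀‖ : ℝ) : EReal))
    {w : Fin N → ℂ} (hw : w i₀ ≠ 0) (hreg : moebius i₀ w ∈ T₁.regularLocus) :
    w ∈ T₂.regularLocus ∧ heightDensity N T₂.chartPotential w
      = Complex.normSq (jacobianMatrix (moebius i₀) w).det
        * heightDensity N T₁.chartPotential (moebius i₀ w) := by
  have hμ2 : ContDiffAt ℝ 2 (moebius i₀) w := contDiffAt_moebius i₀ hw
  have hμc : ContinuousAt (moebius i₀) w := hμ2.continuousAt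
  have hreg1 : ContDiffAt ℝ 2 T₁.chartPotential (moebius i₀ w) := hreg
  -- the germ identity `g₂ = g₁ ∘ μ + c log |·_{i₀}|` near `w`
  have hS : ∀ᶠ y in 𝓝 w, y i₀ ≠ 0 := (isOpen_ne_zero_coord i₀).mem_nhds hw
  have hR : ∀ᶠ y in 𝓝 w, moebius i₀ y ∈ T₁.regularLocus :=
    hμc.eventually_mem (T₁.isOpen_regularLocus.mem_nhds hreg)
  have hgerm : T₂.chartPotential
      =ᶠ[𝓝 w] (T₁.chartPotential ∘ moebius i₀) + fun y ↦ c * Real.log ‖y i₀‖ := by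
    filter_upwards [hS, hR] with y hy hyR
    have hne : T₁.pot (chartVec (moebius i₀ y)) ≠ ⊥ :=
      T₁.pot_chartVec_ne_bot_of_continuousAt
        ((T₁.mem_regularLocus_iff _).1 hyR).continuousAt
    have hlt : T₁.pot (chartVec (moebius i₀ y)) < ⊤ := T₁.pot_lt_top (chartVec_ne_zero _)
    have hcoe : T₁.pot (chartVec (moebius i₀ y)) = ((T₁.chartPotential (moebius i₀ y) : ℝ) : EReal) := by
      rw [chartPotential, EReal.coe_toReal hlt.ne hne]
    simp only [Pi.add_apply, Function.comp_apply]
    rw [chartPotential, hrel y hy, hcoe, ← EReal.coe_add, EReal.toReal_coe]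
  have hh : ContDiffAt ℝ 2 (fun y : Fin N → ℂ ↦ c * Real.log ‖y i₀‖) w :=
    contDiffAt_log_norm_coord i₀ hw c
  have hgμ : ContDiffAt ℝ 2 (T₁.chartPotential ∘ moebius i₀) w := hreg1.comp w hμ2
  have hsum : ContDiffAt ℝ 2 ((T₁.chartPotential ∘ moebius i₀) + fun y ↦ c * Real.log ‖y i₀‖) w :=
    hgμ.add hh
  refine ⟨hsum.congr_of_eventuallyEq hgerm, ?_⟩
  rw [heightDensity_congr_of_eventuallyEq hgerm, heightDensity_self_eq, leviMatrix_add hgμ hh,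
    leviMatrix_log_norm_coord i₀ hw c, add_zero, ← heightDensity_self_eq]
  exact heightDensity_comp_holo hreg1 hμ2 (eventually_fderiv_moebius_I_smul i₀ hw)

/-- `μ` is continuous on `{w_{i₀} ≠ 0}`. [folklore] -/
theorem continuousOn_moebius (i₀ : Fin N) : ContinuousOn (moebius i₀) {w : Fin N → ℂ | w i₀ ≠ 0} :=
  fun _ hw ↦ (contDiffAt_moebius i₀ hw (m := 0)).continuousAt.continuousWithinAt

/-- **Invariance of the regular mass under the chart change.** [folklore] -/
theorem regularMass_eq_of_rel {T₁ T₂ : ClosedPositiveOneOneCurrent N} (i₀ : Fin N) {c : ℝ}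
    (hrel : ∀ w : Fin N → ℂ, w i₀ ≠ 0 →
      T₂.pot (chartVec w) = T₁.pot (chartVec (moebius i₀ w)) + ((c * Real.log ‖w i₀‖ : ℝ) : EReal)) :
    T₂.regularMass N = T₁.regularMass N := by
  have hrel' := rel_symm i₀ hrel
  set S : Set (Fin N → ℂ) := {w | w i₀ ≠ 0} with hSdef
  set A : Set (Fin N → ℂ) := {w | w i₀ ≠ 0 ∧ moebius i₀ w ∈ T₁.regularLocus} with hAdef
  have hSopen : IsOpen S := isOpen_ne_zero_coord i₀
  have hSae : S =ᵐ[volume] (univ : Set (Fin N → ℂ)) := by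
    rw [ae_eq_univ]
    have : Sᶜ = {w : Fin N → ℂ | w i₀ = 0} := by ext w; simp [hSdef]
    rw [this]
    exact volume_coord_eq_zero i₀
  -- `Reg₂ ∩ S = A`
  have hA2 : T₂.regularLocus ∩ S = A := by
    ext w
    constructor
    · rintro ⟨hw2, hwS⟩
      refine ⟨hwS, ?_⟩
      have h := (mem_regularLocus_and_heightDensity_of_rel i₀ hrel' (moebius_apply_self_ne_zero i₀ hwS)
        (by rwa [moebius_moebius i₀ hwS])).1
      exact h
    · rintro ⟨hwS, hw1⟩
      exact ⟨(mem_regularLocus_and_heightDensity_of_rel i₀ hrel hwS hw1).1, hwS⟩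
  have hAopen : IsOpen A :=
    (continuousOn_moebius i₀).isOpen_inter_preimage hSopen T₁.isOpen_regularLocus
  have hAS : A ⊆ S := fun w hw ↦ hw.1
  -- `μ '' A = Reg₁ ∩ S`
  have hμA : moebius i₀ '' A = T₁.regularLocus ∩ S := by
    rw [moebius_image i₀ A hAS]
    ext w
    simp only [hAdef, mem_setOf_eq, mem_inter_iff, hSdef]
    constructor
    · rintro ⟨hw, -, h⟩
      rw [moebius_moebius i₀ hw] at h
      exact ⟨h, hw⟩
    · rintro ⟨h, hw⟩
      exact ⟨hw, moebius_apply_self_ne_zero i₀ hw, by rwa [moebius_moebius i₀ hw]⟩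
  -- the computation
  have hdet : ∀ w ∈ A, |(fderiv ℝ (moebius i₀) w).det|
      = Complex.normSq (jacobianMatrix (moebius i₀) w).det := by
    intro w hw
    rw [det_eq_normSq_det_of_commute_I _ (fderiv_moebius_I_smul i₀ hw.1),
      abs_of_nonneg (Complex.normSq_nonneg _)]
    rfl
  have hae : ∀ R : Set (Fin N → ℂ), R =ᵐ[volume] (R ∩ S : Set (Fin N → ℂ)) := fun R ↦ by
    have h := (ae_eq_refl R).inter hSae
    rw [inter_univ] at h
    exact h.symm
  calc T₂.regularMass N
      = ∫⁻ w in T₂.regularLocus ∩ S, ENNReal.ofReal (heightDensity N T₂.chartPotential w) := by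
        rw [regularMass_def]
        exact setLIntegral_congr (hae _)
    _ = ∫⁻ w in A, ENNReal.ofReal (heightDensity N T₂.chartPotential w) := by rw [hA2]
    _ = ∫⁻ w in A, ENNReal.ofReal |(fderiv ℝ (moebius i₀) w).det|
          * ENNReal.ofReal (heightDensity N T₁.chartPotential (moebius i₀ w)) := by
        refine setLIntegral_congr_fun hAopen.measurableSet fun w hw ↦ ?_
        rw [(mem_regularLocus_and_heightDensity_of_rel i₀ hrel hw.1 hw.2).2, hdet w hw,
          ENNReal.ofReal_mul (Complex.normSq_nonneg _)]
    _ = ∫⁻ w in moebius i₀ '' A, ENNReal.ofReal (heightDensity N T₁.chartPotential w) := by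
        rw [lintegral_image_eq_lintegral_abs_det_fderiv_mul volume hAopen.measurableSet
          (fun w hw ↦ ((contDiffAt_moebius i₀ hw.1 (m := 1)).differentiableAt
            one_ne_zero).hasFDerivAt.hasFDerivWithinAt)
          ((injOn_moebius i₀).mono hAS)]
    _ = ∫⁻ w in T₁.regularLocus ∩ S, ENNReal.ofReal (heightDensity N T₁.chartPotential w) := by
        rw [hμA]
    _ = T₁.regularMass N := by
        rw [regularMass_def]
        exact (setLIntegral_congr (hae _)).symm

/-- **Chart change by a transposition of homogeneous coordinates** (statement consumed by the proof
of `GuedjZeriahi2007_lelongNumber_eq_zero_of_regularMass_eq`): there is a current of the same degree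
and the same regular Monge–Ampère mass whose Lelong numbers are those of `T` transported by the
transposition `z₀ ↔ z_i`. [folklore] -/
theorem exists_swap (i : Fin (N + 1)) :
    ∃ T' : ClosedPositiveOneOneCurrent N, T'.degree = T.degree ∧
      T'.regularMass N = T.regularMass N ∧
      ∀ v : Fin (N + 1) → ℂ, v ≠ 0 →
        Pluripotential.lelongNumber T'.pot (fun j ↦ v (Equiv.swap 0 i j))
          = Pluripotential.lelongNumber T.pot v := by
  rcases Fin.eq_zero_or_eq_succ i with rfl | ⟨i₀, rfl⟩
  · exact ⟨T, rfl, rfl, fun v _ ↦ by simp [Equiv.swap_self]⟩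
  · refine ⟨T.reindex (Equiv.swap 0 i₀.succ), rfl, ?_, fun v _ ↦ ?_⟩
    · exact regularMass_eq_of_rel i₀ (fun w hw ↦ T.reindex_swap_pot_chartVec i₀ hw)
    · rw [lelongNumber_reindex_pot]
      congr 1
      funext j
      simp [Equiv.swap_apply_self]

end ClosedPositiveOneOneCurrent

end Literature.Analysis.Pluripotential

end
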